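import Summits.CriticalPhenomena.PercolationContinuityZ3.Theorems.Transplant.SkelPhiConcFaceContact
import Summits.CriticalPhenomena.PercolationContinuityZ3.Theorems.Transplant.SkelPhiWinChainKits
import HarnessLib

/-!
# D″ node, (F) part 12 at φ-level (DPRIME-SCOPE §2 L6′; hp-8 column): the KITS OF THE INNER CHAIN about a kit centre `c` — the abstract
# `hKits` of parts 7/8/10 (`link_lt_of_schedChain`, `routeClause_of_schedChain`, `hroute_faceStepW_of_sched`) DISCHARGED for any planar
# schedule `Sch` read through `planarWindowWin hlip c L` under the route law `Skel.routeW G Wt (schedQt …) S` (seed `S ∋ c` wired, missing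
# the region windows): p1-g9's `WinChainData.kitsAt_stepA_win'` (two-scale kit clause from the Step-I′ certificate, `hj₀` form) with the
# law/support/rim facts of parts 5b/6 — schedule-generic φ-level re-cut of `SkelConcFaceInnerKits.innerKits'` (hp-8 g25)

builds on p205010 (kernel theorem, internal audit signed; external expert review pending) — nothing in this file uses p205010.
Lane `prim-bschramm`, seat `prim-hp-8` (gen 30; L6′ (F) owner); helper file (`--supports stmt-CriticalPhenomena-4575`).  Hypotheses through
p3-g7's dictionary (`hlip hstep hfr hκ`, `hΔ`, `hC`), the Step-I′ datum/certificate (accuracy `δ²`), the kit scalars and rooms of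
`kitClause_stepI` with the inner window depth `L ≥ r₀`, the schedule's route rooms (zone scale below `ℓ₀`, certified extents along the
axis of every step, depth, spread), the inner chain data (`Rlev + 1 ≤ R'`, `tanOff ℓs M ≤ j₀ ≤ j₁ ≤ Rlev`, rim depth `Lr ≥ r₀`, count).
* `inNbr_mem_coreE_of_far` (far inner neighbours of an inner level lie in the rim part `schedRim k` of the enlarged target);
* **`kitsAt_schedChain (hlip) (hstep) (hfr) (hκ)`**.
[cite: KozmaNitzan2024, §4 Lemma 10 Steps III–V (pp. 19–22), Lemma 11 (pp. 22–23), Lemma 12 (pp. 23–25)]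
-/

noncomputable section

open MeasureTheory ProbabilityTheory
open scoped ENNReal Classical

namespace Summit.CriticalPhenomena.PercolationContinuityZ3.Theorems.Transplant

namespace Skelφ

open Literature.Probability.Percolation Literature.Probability.LatticeModels SimpleGraph
open Literature.Probability.Percolation.KozmaNitzan
open Literature.Probability.Percolation.KozmaNitzan.Cells (oth oth_ne eq_oth_of_ne)
open Literature.Barriers.CriticalPhenomena (graphBall graphBall_finite mem_graphBall_self graphBall_mono)
open KNLevels ChainPlanar
open Skel (winGraph winGraph_adj winGraph_le routeW excess)
open SkelI (tanOff)

variable {V : Type} [DecidableEq V] [Countable V] {G : SimpleGraph V} [G.LocallyFinite] {φ : V → Site 2} {types : Finset V}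

omit [Countable V] in
/-- **Far inner neighbours lie in the rim part**: an inner neighbour of level `j ≤ R'` of step `k ≤ N` beyond graph distance `L − r₀` from the
window centre lies in `schedRim k` (`r₀ ≤ Lr`), hence in the enlarged target `coreE k`. [cite: KozmaNitzan2024, §4 p. 20 (Step IV)] -/
theorem inNbr_mem_coreE_of_far (hlip : Lip G φ) {c : V} {L Lr r₀ : ℕ} (hr₀ : r₀ ≤ Lr) {F : Finset (Site 2)} {Sch : Schedule} {o : V}
    {Rlev N j₀ j₁ : ℕ} {k : ℕ} (hk : k ≤ Sch.N) {j : ℕ} (hj : j ≤ Sch.R') {x : V}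
    (hx : x ∈ outerBoundary (winGraph G c L) (winLevel G φ c L (Sch.lo k) (Sch.hi k) j))
    (hfar : inNbr G φ c L (Finset.Icc (Sch.lo k - (j : Site 2)) (Sch.hi k + (j : Site 2))) x ∉ graphBall G c (L - r₀)) :
    inNbr G φ c L (Finset.Icc (Sch.lo k - (j : Site 2)) (Sch.hi k + (j : Site 2))) x ∈
      (schedChain G φ c L Lr F Sch o Rlev N j₀ j₁).coreE (planarWindowWin hlip c L) Sch k := by
  have hx' : x ∈ outerBoundary (winGraph G c L) (Win G φ c (Finset.Icc (Sch.lo k - (j : Site 2)) (Sch.hi k + (j : Site 2))) L) := hx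
  obtain ⟨-, hyB, hyP⟩ := inNbr_spec hx'
  refine Finset.mem_union_right _ ?_
  show _ ∈ schedRim G φ c L Lr Sch k
  rw [schedRim, Finset.mem_filter]
  refine ⟨?_, fun hy => hfar (graphBall_mono G c (by omega) hy)⟩
  have := winLevel_subset_stepD_win hlip Sch c L hk hj ((mem_winLevel_iff G φ).2 ⟨hyB, hyP⟩)
  rwa [PlanarWindow.stepD, planarWindowWin_W] at this

/-- **THE KITS OF THE INNER CHAIN** (`hKits` of `link_lt_of_schedChain` / `routeClause_of_schedChain`): `KitsAt` of every step `k ≤ N` of the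
chain of `Sch` read through the plain window of depth `L` about `c`, under the route law `routeW Wt Qt S` — p1-g9's `kitsAt_stepA_win'`
(kit clause of every level from the Step-I′ certificate) with: the region windows subboxes of the route law (part 6), the law supported on
the route world, the source `c ∈ S` off every region window, nonempty true targets (`Steps` + the `ℓ¹`-reach of the cores), far inner
neighbours in the rim part. [cite: KozmaNitzan2024, §4 Lemma 10 (pp. 17–22), Lemma 11 (pp. 22–23), Lemma 12 (pp. 23–25)] -/
theorem kitsAt_schedChain (hlip : Lip G φ) (hstep : Steps G φ) (hfr : Frames G φ types) (hκ : CylConn G φ types) {Δ : ℕ}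
    (hΔ : ∀ v, G.degree v ≤ Δ) {p : unitInterval} (hC : CylSubcritical G φ types p) {D : StepI.Data V} {off : ℕ}
    (hD : D.Λ = fatSeqOff hfr hC off) {Sz Sx Sy : Finset ℕ} {q : unitInterval} {δ : ℝ} (hδ : 0 < δ)
    (h : ∀ i ∈ StepI.index types Sz Sx Sy, 1 - δ ^ 2 < (bondPercolation G q).real (StepI.event G φ D i))
    -- the kit (as `kitClause_stepI`)
    {Mz : ℕ} (hMz : Mz ∈ Sz) (hkz : D.k ≤ Mz) {ℓK : Fin 2 → ℕ} (hℓK0 : ∀ I, I = 0 → ℓK I ∈ Sx) (hℓK1 : ∀ I, I = 1 → ℓK I ∈ Sy)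
    {A : Fin 2 → Fin 2 → ℕ} {Rk : Fin 2 → ℕ} (hAw : ∀ I, A I = StepI.widths D.Gb D.Fb I (ℓK I)) (hRk : ∀ I, Rk I = D.R (amax (A I)))
    {ℓs M K R' r₀ rs : ℕ} (hℓs : 1 ≤ ℓs) (hA : ∀ i k, A i k ≤ M) (hAℓ : ∀ i, A i (oth i) ≤ ℓs) (hK : ∀ i, ℓs + 1 + A i i + Rk i ≤ K)
    (hnA : ∀ i, Mz + 1 ≤ A i i) (hnM : Mz ≤ M) (hρK : ∀ i, ℓs + 1 + A i i + (fatRadius hfr hC Mz + off) ≤ K)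
    (hR'₁ : cylRadMax G φ types ℓs (ℓs + 2 + 2 * tanOff ℓs M) ≤ R') (hR'₂ : ∀ i, cylRadMax G φ types ℓs (ℓs + 2 + A i i + Rk i) ≤ R')
    (hr₀₁ : ℓs + 1 + tanOff ℓs M + R' ≤ r₀) (hr₀₂ : ℓs + 2 + tanOff ℓs M + K ≤ r₀)
    (hrs₁ : ℓs + 2 + tanOff ℓs M + R' ≤ rs) (hrs₂ : ℓs + 2 + tanOff ℓs M + K ≤ rs) {cU : ℕ} (hcU : ∀ i, (Δ + 1) ^ Rk i ≤ cU)
    -- the chain about `c`: window depth, schedule, first-hop footprint, wired seed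
    {c : V} {L : ℕ} (hr₀L : r₀ ≤ L) (Sch : Schedule) {F : Finset (Site 2)} {S : Finset V} (hcS : c ∈ S)
    (hSQ : S ⊆ schedQt G φ c L F Sch) (hSD : ∀ k ≤ Sch.N, Disjoint S ((planarWindowWin hlip c L).stepD Sch k))
    (hreach : ∀ k ≤ Sch.N, ∃ y ∈ Sch.core (k + 1), (y 0 - φ c 0).natAbs + (y 1 - φ c 1).natAbs ≤ L)
    -- the outer law and the route world inside its region
    {w₀ : V} {R : ℕ} {Wt : Sym2 V → unitInterval} {Rg : Finset V} (hWG : ∀ e, e ∉ G.edgeSet → Wt e = 0)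
    (hWD : IsSubbox (winGraph G w₀ R) Wt q Rg) (hRg : ∀ u ∈ Rg, u ∈ graphBall G w₀ R) (hQ : schedQt G φ c L F Sch ⊆ Rg)
    -- the inner chain data
    {Lr Rlev N j₀ j₁ : ℕ} (hr₀Lr : r₀ ≤ Lr) (hRl : Rlev + 1 ≤ Sch.R') (hj : j₁ ≤ Rlev) (hj₀ : tanOff ℓs M ≤ j₀)
    (hcount : 1 / (1 - (q : ℝ)) ^ (Δ * N) ≤ δ * ((Finset.Icc j₀ j₁).card : ℝ))
    -- the route rooms of the schedule
    (hMℓ : Mz + 1 ≤ Sch.ℓ₀) (hS0 : ∀ k ≤ Sch.N, Sch.ax k = 0 → ∀ ℓ, Sch.ℓ₀ ≤ ℓ → ℓ ≤ Sch.ℓ₁ → ℓ ∈ Sx)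
    (hS1 : ∀ k ≤ Sch.N, Sch.ax k = 1 → ∀ ℓ, Sch.ℓ₀ ≤ ℓ → ℓ ≤ Sch.ℓ₁ → ℓ ∈ Sy)
    (hdepth : ∀ k ≤ Sch.N, ∀ I ℓ, Sch.ℓ₀ ≤ ℓ → ℓ ≤ Sch.ℓ₁ →
      2 * ℓs + 2 + tanOff ℓs M + A I I + D.R (amax (StepI.widths D.Gb D.Fb (Sch.ax k) ℓ)) ≤ r₀)
    (hWr : ∀ k ≤ Sch.N, ∀ ℓ, Sch.ℓ₀ ≤ ℓ → ℓ ≤ Sch.ℓ₁ → StepI.widths D.Gb D.Fb (Sch.ax k) ℓ (oth (Sch.ax k)) ≤ Sch.Wb k ℓ)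
    -- the kit number
    (kk : ℕ) (hN : kk * (Δ + 1) ^ (2 * rs) ≤ N)
    (hkk : (1 - (q : ℝ) ^ (1 + Δ * ((Δ + 1) ^ R' + (tanOff ℓs M + 2)) + ((Δ + 1) ^ R' + (tanOff ℓs M + 2)) * cU)) ^ kk ≤ δ) :
    ∀ k ≤ Sch.N, ((schedChain G φ c L Lr F Sch c Rlev N j₀ j₁).stepA (planarWindowWin hlip c L) Sch k).KitsAt
      (routeW G Wt (schedQt G φ c L F Sch) S) q Δ δ := by
  intro k hk
  refine (schedChain G φ c L Lr F Sch c Rlev N j₀ j₁).kitsAt_stepA_win' hlip hstep hfr hκ hΔ hC hD hδ h Sch hRl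
    (fun k' => schedRim_subset_stepD hlip c L Lr Sch k') hk (coreT_nonempty_of_steps hlip hstep (hreach k hk))
    (isSubbox_routeW_schedStepD hlip hWG hWD hRg hQ hk (hSD k hk)) (Skel.finSupp_routeW G Wt _ S) (stepD_subset_schedQt hlip F hk)
    (fun hc => Finset.disjoint_left.1 (hSD k hk) hcS hc) (hSQ hcS) hj hcount hMz hkz hℓK0 hℓK1 hAw hRk hℓs hj₀ hA hAℓ hK hnA hnM hρK
    hR'₁ hR'₂ hr₀₁ hr₀₂ hr₀L hrs₁ hrs₂ hcU hMℓ (hS0 k hk) (hS1 k hk) (hdepth k hk) (hWr k hk) (fun j hjm x hx hfar => ?_) kk hN hkk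
  have hjR : j ≤ Sch.R' := (((Finset.mem_Icc.1 hjm).2.trans hj).trans (Nat.le_succ _)).trans hRl
  exact inNbr_mem_coreE_of_far hlip hr₀Lr hk hjR hx hfar

end Skelφ

end Summit.CriticalPhenomena.PercolationContinuityZ3.Theorems.Transplant

end
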